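import Summits.Parity.GeneralizedHardyLittlewood.Theorems.LeeYangFibresAbsoluteUpgradeSinglesDecay
import Summits.Parity.GeneralizedHardyLittlewood.Theorems.TwinLowerDensityToGHLUniformUpperBoundPrelims
import HarnessLib

/-!
# Uniform Brun–Titchmarsh for affine prime tuples in Green–Tao's normalisation
(crux `TwinLowerDensityToGHL`, stmt-Parity-18380; the unconditional UPPER-HALF RUNG of the conclusion of the
registered stub `stub_shiftLift` = of `GeneralizedHardyLittlewoodDimOne`, stmt-Parity-0819)

**Theorem** (`uniformUpperBound`).  For all `t ≥ 1` and `L` there is `C = C(t, L) > 0` such that for every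
`ε > 0`, eventually in `N`, for EVERY non-degenerate system `Ψ = (ψ₁, …, ψ_t)` of affine-linear forms on `ℤ`
with `‖Ψ‖_N ≤ L` (slopes `|aᵢ| ≤ L`, shifts `|bᵢ| ≤ L N`) and every convex `K ⊆ [−N, N]`,

  `∑_{n ∈ K ∩ ℤ} ∏ᵢ Λ(ψᵢ(n)) ≤ C · β_∞(Ψ, K) · ∏_p β_p(Ψ) + ε N`.

That is: the Dickson–Hardy–Littlewood main term bounds the prime-tuple sum from ABOVE up to the constant `C`,
uniformly over all shifts up to `L N` — pairs `(n, n + h)` uniformly in `h ≤ L N`, Goldbach `(n, M − n)`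
uniformly in `M ≤ L N`, prime `t`-tuples in progressions — with the singular product kept (not absorbed into
`(log log N)^t` as in the tree's cruder `Literature.NumberTheory.Sieve.uniformRoughTupleBound`).  The constant is
`C = 2 (1 + C_FL) 34^t`, `C_FL = C_FL(t, L)` the constant of the tree's Fundamental Lemma
(`SieveSequence.fundamental_lemma_uniform_holds`) at sieve dimension `2(L + t)`: an EXPONENTIAL loss in `t`.
A SUB-exponential loss `e^{o(t)}` would already give the sharp upper half `UpperRelativeDimOne` of the crux and is
`UniformCharPNT`-hard (tree: `upperRelativeDimOne_of_coarseUpperHLSlack`, `uniformCharPNT_of_coarseUpperHLSlack`);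
the two-sided statement with `C = 1` is `GeneralizedHardyLittlewoodDimOne` itself.  So this file is the honest
one-sided, constant-losing content of the stub `stub_shiftLift`'s conclusion that sieve methods deliver
unconditionally — a RUNG, zero stub credit.

Proof (all engines are tree theorems of the `AbsoluteUpgrade` line of route `LeeYangFibres` and of
`Literature/NumberTheory/Sieve`): with `y = N^{1/17}`, `z = ⌊y⌋ + 1 ≤ D = N^{1/8}`,
* `∑ ∏ Λ(ψᵢ n) ≤ log^t(2LN) (#R_y + 2t(2y+1) + t √(2LN) log₂(2LN))`, `R_y` the points of `K` all of whose values
  are `y`-rough (prelims, from the tree's sandwich `vonMangoldtSum_primePointCount_sandwich`);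
* a local obstruction of `F_Ψ = ∏ ψ_k` (`ω_F(p) = p`, forcing `p ≤ L + t ≤ y`) empties `R_y`
  (`roughTuples_eq_empty_of_obstructed`); otherwise the root density of `F_Ψ` has sieve dimension `2(L + t)`
  (`hasSieveDimension_sysPoly`), the rough points of the interval `I` of positive lattice points of `K`
  (`exists_interval`, `#I ≤ β_∞ + 1`) are sifted (`rough_subset_coprime`), and the upper-bound sieve
  `sifted_card_le` gives `#R_y ≤ (1 + C_FL) #I V(z) + ∑_{d ≤ D sqfree} ω_F(d)` with `∑ ω_F(d) ≤ ⌊D⌋²`;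
* `V(z) ≤ 2 ∏_p β_p (17/log N)^t` (`prod_one_sub_rootCount_le_main`), `V(z) ≤ 1`, and
  `log(2LN) · 17/log N ≤ 34`; the junk is `O((log N)^{t+1} √N) ≤ ε N` (prelims `eventually_junk_le`).

Corollary (companion file `…UniformUpperBoundPairs.lean`, through the tree's shift-pair dictionary):
Brun–Titchmarsh for prime pairs UNIFORMLY in the shift — `∑_{n ≤ N} Λ(n)Λ(n+h) ≤ C 𝔖({0,h}) N + ε N` for all
`1 ≤ h ≤ N`; the two-sided version (error `≤ ε N`) is the `t = 2` slice of `GeneralizedHardyLittlewoodDimOne`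
and FAILS at `h = 2q`, `N = q^{10}` under Siegel zeros of unbounded quality (tree
`not_generalizedHardyLittlewoodDimOne_of_unboundedSiegelZeros`, mod Matomäki–Merikoski).

References: H. Halberstam, H.-E. Richert, *Sieve Methods* (1974), Thm. 2.2, Thm. 2.5, §5.7 [HalberstamRichert1974];
J. Friedlander, H. Iwaniec, *Opera de Cribro* (2010), Thm. 6.9, Cor. 6.10 [FriedlanderIwaniecOpera2010];
B. Green, T. Tao, *Linear equations in primes*, Ann. of Math. 171 (2010), Conj. 1.2, (1.6)–(1.7), §1 [GreenTao2010].
-/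

noncomputable section

open Finset Filter
open scoped Classical

namespace Summit.Parity.GeneralizedHardyLittlewood.TwinLowerDensityToGHLUniformUpperBound

open Literature.NumberTheory.Sieve
open Summit.Parity.GeneralizedHardyLittlewood.Theorems.AbsoluteUpgrade
open Summit.Parity.GeneralizedHardyLittlewood.Cruxes.AbsoluteUpgrade.NlcCellsAbsoluteClip (roughTuples)

variable {t : ℕ}

/-! ### The rough points of one scale -/

/-- **Sieve bound for the rough points at one scale (no local obstruction).**  With the Fundamental Lemma
constant `C_FL` (dimension `2(L+t)`), `y = N^{1/17} ≥ L + 4t² + t + 2`, `y + 1 ≤ N^{1/8}`: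
`#{n ∈ K ∩ [-N,N] : P⁻(ψ_k(n)) > y ∀ k} ≤ 2(1 + C_FL) (β_∞ ∏_p β_p) (17/log N)^t · (…) ` — precisely,
`log^t(2LN) · ((1 + C_FL) #I V) ≤ 2 (1 + C_FL) 34^t β_∞ ∏_p β_p + (1 + C_FL) log^t(2LN)` after sifting, where
the rough count is `≤ (1 + C_FL) #I V + ⌊N^{1/8}⌋²`; we return the combined consequence
`log^t(2LN) · #R_y ≤ 2 (1 + C_FL) 34^t β_∞ ∏_p β_p + log^t(2LN) ((1 + C_FL) + ⌊N^{1/8}⌋²)`.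
[cite: FriedlanderIwaniecOpera2010, Cor. 6.10] [cite: GreenTao2010, (1.6)–(1.7)] -/
theorem rough_main_le {κ Kd CFL : ℝ} (hCFL0 : 0 ≤ CFL)
    (hFL : ∀ A : SieveSequence, HasSieveDimension A.density κ Kd →
      ∀ x z D : ℝ, 2 ≤ z → z ≤ D → 0 ≤ A.size x →
        |A.sifted x (primesProdBelow z) - A.size x * A.densityProduct (primesProdBelow z)| ≤
          CFL * A.size x * A.densityProduct (primesProdBelow z) *
              Real.exp (-(Real.log D / Real.log z)) +
            ∑ d ∈ (primesProdBelow z).divisors.filter (fun d : ℕ => (d : ℝ) ≤ D),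
              |A.remainder d x|)
    {L : ℕ} (hκ : κ = 2 * ((L + t : ℕ) : ℝ))
    (hKd : Kd = ((2 * (L + t) + 1 : ℕ) : ℝ) ^ (2 * (L + t) + 1) *
      Real.exp (2 * ((L + t : ℕ) : ℝ) * (9 / 2 + 6 / Real.log 2)))
    {N : ℕ} (h16 : (16 : ℝ) ≤ N) (hlog1 : 1 ≤ Real.log N)
    (hB17 : (L : ℝ) + 4 * t ^ 2 + t + 2 ≤ (N : ℝ) ^ ((1 : ℝ) / 17))
    (hlevel : (N : ℝ) ^ ((1 : ℝ) / 17) + 1 ≤ (N : ℝ) ^ ((1 : ℝ) / 8))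
    (h2L : ((2 * L : ℕ) : ℝ) ≤ N) (ht : 1 ≤ t)
    {Ψ : Fin t → AffLinForm 1} (hΨ : IsNondegenerateSystem Ψ) (hL : affLinSize Ψ N ≤ L)
    {K : Set (Fin 1 → ℝ)} (hK : Convex ℝ K) (hKN : K ⊆ realBox 1 N) :
    Real.log (2 * L * N) ^ t *
        (#((latticeBox 1 N).filter (fun n => realPoint n ∈ K ∧
          ∀ i, (N : ℝ) ^ ((1 : ℝ) / 17) < (Nat.minFac ((Ψ i).eval n).toNat : ℝ))) : ℝ) ≤
      2 * (1 + CFL) * 34 ^ t * (archFactor Ψ K * singularProduct Ψ) +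
        Real.log (2 * L * N) ^ t * ((1 + CFL) + (⌊(N : ℝ) ^ ((1 : ℝ) / 8)⌋₊ : ℝ) ^ 2) := by
  -- basics
  have hNpos : (0 : ℝ) < N := by linarith
  have hN1r : (1 : ℝ) ≤ N := by linarith
  have hlogpos : 0 < Real.log N := by linarith
  have haL : ∀ k, ((Ψ k).coeff 0).natAbs ≤ L := fun k => natAbs_coeff_le_of_affLinSize_le hL k 0
  have hAF0 : 0 ≤ archFactor Ψ K := archFactor_nonneg Ψ K
  have hSP0 : 0 ≤ singularProduct Ψ :=
    ge_of_tendsto' (tendsto_singularProductPartial_holds 1 t Ψ hΨ)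
      fun x => Finset.prod_nonneg fun p _ => localFactor_nonneg Ψ p
  have hL1 : (1 : ℝ) ≤ L := one_le_of_affLinSize_le Ψ hΨ hL ⟨0, ht⟩
  have ht0 : (0 : ℝ) ≤ t := Nat.cast_nonneg t
  have hL0 : (0 : ℝ) ≤ L := Nat.cast_nonneg L
  set y : ℝ := (N : ℝ) ^ ((1 : ℝ) / 17) with hy
  have h4t : (0 : ℝ) ≤ 4 * (t : ℝ) ^ 2 := by positivity
  have hy2 : (2 : ℝ) ≤ y := by
    have : (2 : ℝ) ≤ (L : ℝ) + 4 * t ^ 2 + t + 2 := by linarith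
    exact this.trans hB17
  have hy1 : (1 : ℝ) ≤ y := by linarith
  have hy0 : (0 : ℝ) ≤ y := by linarith
  -- the logarithmic weight `b = log(2LN) ≤ 2 log N` and `b · 17/log N ≤ 34`
  set b : ℝ := Real.log (2 * L * N) with hb
  have h2LN1 : (1 : ℝ) ≤ 2 * L * N :=
    calc (1 : ℝ) = 1 * 1 := by ring
      _ ≤ (2 * L) * N := mul_le_mul (by linarith) hN1r zero_le_one (by linarith)
      _ = 2 * L * N := by ring
  have hb0 : 0 ≤ b := Real.log_nonneg h2LN1
  have hb2 : b ≤ 2 * Real.log N := by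
    have h2L' : (2 * L : ℝ) ≤ N := by exact_mod_cast h2L
    calc b = Real.log (2 * L) + Real.log N := by
          rw [hb, Real.log_mul (by positivity) (by positivity)]
      _ ≤ Real.log N + Real.log N := by
          have := Real.log_le_log (by positivity) h2L'
          linarith
      _ = 2 * Real.log N := by ring
  have hbt : 0 ≤ b ^ t := pow_nonneg hb0 t
  set W : ℝ := (17 : ℝ) / Real.log N with hW
  have hW0 : 0 ≤ W := by positivity
  have hbW : b * W ≤ 34 := by
    rw [hW]
    calc b * (17 / Real.log N) = 17 * b / Real.log N := by ring
      _ ≤ 17 * (2 * Real.log N) / Real.log N := by gcongr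
      _ = 34 := by field_simp; ring
  -- the rough set
  set R : Finset (Fin 1 → ℤ) := (latticeBox 1 N).filter (fun n => realPoint n ∈ K ∧
    ∀ i, y < (Nat.minFac ((Ψ i).eval n).toNat : ℝ)) with hR
  have hRHS0 : 0 ≤ 2 * (1 + CFL) * 34 ^ t * (archFactor Ψ K * singularProduct Ψ) +
      b ^ t * ((1 + CFL) + (⌊(N : ℝ) ^ ((1 : ℝ) / 8)⌋₊ : ℝ) ^ 2) := by positivity
  -- Case 1: a local obstruction empties the rough set
  by_cases hobs : ∃ p : ℕ, p.Prime ∧ polyRootCountMod ![sysPoly Ψ] p = p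
  · obtain ⟨p, hp, hρ⟩ := hobs
    have hpL : polyRootCountMod ![sysPoly Ψ] p ≤ L + t := rootCount_le_add hΨ haL hp
    rw [hρ] at hpL
    have e17 : ((1 : ℝ) / ((17 : ℕ) : ℝ)) = (1 : ℝ) / 17 := by norm_num
    have hpy : (p : ℝ) ≤ (N : ℝ) ^ ((1 : ℝ) / ((17 : ℕ) : ℝ)) := by
      rw [e17]
      refine le_trans ?_ hB17
      have h1 : (p : ℝ) ≤ (L : ℝ) + t := by exact_mod_cast hpL
      linarith
    have hy2' : (2 : ℝ) ≤ (N : ℝ) ^ ((1 : ℝ) / ((17 : ℕ) : ℝ)) := by rw [e17]; exact hy2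
    have hempty := roughTuples_eq_empty_of_obstructed Ψ hp hρ hpy hy2' K
    have hRempty : R = ∅ := by
      unfold roughTuples at hempty
      rw [e17] at hempty
      exact hempty
    rw [hRempty, Finset.card_empty, Nat.cast_zero, mul_zero]
    exact hRHS0
  -- Case 2: no local obstruction
  push Not at hobs
  have hlt : ∀ p : ℕ, p.Prime → polyRootCountMod ![sysPoly Ψ] p < p := fun p hp =>
    lt_of_le_of_ne (polyRootCountMod_le _ p) (hobs p hp)
  have hdim : HasSieveDimension (rootDensity (sysPoly Ψ)) κ Kd := by
    rw [hκ, hKd]; exact hasSieveDimension_sysPoly hΨ haL hlt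
  -- the interval of positive lattice points and its rough points
  obtain ⟨m₁, m₂, hI, hcardI⟩ := exists_interval Ψ hK hKN
  have hIpos : ∀ m ∈ Icc m₁ m₂, ∀ k, 1 ≤ (Ψ k).eval (fun _ => m) := fun m hm => ((hI m).mp hm).2.2
  set RI : Finset ℤ := (Icc m₁ m₂).filter (fun m : ℤ => ∀ k, y <
    (Nat.minFac ((Ψ k).eval (fun _ => m)).toNat : ℝ)) with hRI
  have hRle : (#R : ℝ) ≤ #RI := by
    have h1 : (#R : ℝ) = ∑ n ∈ R, (1 : ℝ) := by simp
    rw [h1, hR, sum_filter_latticeBox]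
    simp only [Finset.sum_const, nsmul_eq_mul, mul_one]
    refine Nat.cast_le.mpr (Finset.card_le_card fun m hm => ?_)
    simp only [Finset.mem_filter] at hm
    obtain ⟨hm, hK', hr⟩ := hm
    rw [hRI, Finset.mem_filter]
    exact ⟨(hI m).mpr ⟨hm, hK', fun k => one_le_of_rough hy2 (hr k)⟩, hr⟩
  -- sifting: rough points of `I` are coprime to `P(z)`, `z = ⌊y⌋ + 1 ≤ D = N^{1/8}`
  set z : ℝ := ((⌊y⌋₊ + 1 : ℕ) : ℝ) with hz
  set D : ℝ := (N : ℝ) ^ ((1 : ℝ) / 8) with hD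
  set F := sysPoly Ψ with hF
  have hyz : y < z := by rw [hz]; push_cast; exact Nat.lt_floor_add_one y
  have hz1 : (1 : ℝ) < z := lt_of_le_of_lt hy1 hyz
  have hfloor2 : 2 ≤ ⌊y⌋₊ := Nat.le_floor (by exact_mod_cast hy2)
  have hz2 : (2 : ℝ) ≤ z := by rw [hz]; push_cast; exact_mod_cast (show (2 : ℕ) ≤ ⌊y⌋₊ + 1 by omega)
  have hzD : z ≤ D := by
    rw [hz, hD]; push_cast
    linarith [Nat.floor_le hy0]
  have hsub2 := (rough_subset_coprime Ψ hIpos hy1).1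
  have hFpos : ∀ m ∈ Icc m₁ m₂, 0 < F.eval m ∧
      ((F.eval m : ℤ) : ℝ) ≤ ∑ m' ∈ Icc m₁ m₂, ((F.eval m' : ℤ) : ℝ) := by
    have hpos : ∀ m ∈ Icc m₁ m₂, 0 < F.eval m := fun m hm => by
      rw [hF, sysPoly_eval]
      exact Finset.prod_pos fun k _ => lt_of_lt_of_le zero_lt_one (hIpos m hm k)
    intro m hm
    refine ⟨hpos m hm, ?_⟩
    have h := Finset.single_le_sum (f := fun m' : ℤ => F.eval m') (fun m' hm' => (hpos m' hm').le) hm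
    exact_mod_cast h
  have hcardle := sifted_card_le hCFL0 hFL hdim hFpos hz2 hzD
  -- the sieve product and the remainder
  have hV1 := prod_one_sub_rootCount_le_one F z
  have hV0 := prod_one_sub_rootCount_nonneg F z
  have hW' : 1 / Real.log z ≤ W := by
    have e : (1 : ℝ) / ((17 : ℕ) : ℝ) = (1 : ℝ) / 17 := by norm_num
    have h := one_div_log_le (N := N) (u := 17) (by norm_num) (by rw [e, ← hy]; linarith)
      (by rw [e, ← hy]; exact hyz)
    have e' : ((17 : ℕ) : ℝ) = 17 := by norm_num
    rwa [e'] at h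
  have hceil : ⌈z⌉₊ - 1 = ⌊y⌋₊ := by rw [hz, Nat.ceil_natCast, Nat.add_sub_cancel]
  have hhead : L ≤ ⌈z⌉₊ - 1 ∧ 4 * t ^ 2 ≤ ⌈z⌉₊ - 1 ∧ 1 ≤ ⌈z⌉₊ - 1 := by
    rw [hceil]
    refine ⟨Nat.le_floor ?_, Nat.le_floor ?_, by omega⟩
    · have : (L : ℝ) ≤ (L : ℝ) + 4 * t ^ 2 + t + 2 := by linarith
      exact this.trans hB17
    · have : ((4 * t ^ 2 : ℕ) : ℝ) ≤ (L : ℝ) + 4 * t ^ 2 + t + 2 := by push_cast; linarith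
      exact this.trans hB17
  have hV := prod_one_sub_rootCount_le_main hΨ haL hz1 hhead hW'
  have hω := sum_rootCount_le_sq F D
  -- assembly
  set V := ∏ p ∈ Nat.primesBelow ⌈z⌉₊, (1 - (polyRootCountMod ![F] p : ℝ) / p) with hVdef
  have hmain := upper_assembly (t := t) hCFL0 hcardI hAF0 hSP0 hW0 hb0 hV0 hV1 hV hbW
  have hRtot : (#R : ℝ) ≤ (1 + CFL) * #(Icc m₁ m₂) * V + (⌊D⌋₊ : ℝ) ^ 2 := by
    have h1 : (#RI : ℝ) ≤ #((Icc m₁ m₂).filter (fun m : ℤ => (F.eval m).natAbs.Coprime (primesProdBelow z))) := by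
      exact_mod_cast Finset.card_le_card hsub2
    linarith
  calc b ^ t * (#R : ℝ) ≤ b ^ t * ((1 + CFL) * #(Icc m₁ m₂) * V + (⌊D⌋₊ : ℝ) ^ 2) :=
        mul_le_mul_of_nonneg_left hRtot hbt
    _ = b ^ t * ((1 + CFL) * #(Icc m₁ m₂) * V) + b ^ t * (⌊D⌋₊ : ℝ) ^ 2 := by ring
    _ ≤ (2 * (1 + CFL) * 34 ^ t * (archFactor Ψ K * singularProduct Ψ) + (1 + CFL) * b ^ t) +
          b ^ t * (⌊D⌋₊ : ℝ) ^ 2 := by linarith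
    _ = 2 * (1 + CFL) * 34 ^ t * (archFactor Ψ K * singularProduct Ψ) +
          b ^ t * ((1 + CFL) + (⌊D⌋₊ : ℝ) ^ 2) := by ring

/-! ### The theorem -/

/-- **Uniform Brun–Titchmarsh for affine prime `t`-tuples (Green–Tao normalisation).**  For `t ≥ 1` and `L`
there is `C = C(t, L) > 0` (`= 2 (1 + C_FL) 34^t`) such that for every `ε > 0`, for all large `N`, all
non-degenerate `Ψ : Fin t → AffLinForm 1` with `‖Ψ‖_N ≤ L`, and all convex `K ⊆ [−N, N]`:
`∑_{n ∈ K ∩ ℤ} ∏ᵢ Λ(ψᵢ(n)) ≤ C · β_∞(Ψ, K) ∏_p β_p(Ψ) + ε N`.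
The UPPER half of the conclusion of `stub_shiftLift` (= of `GeneralizedHardyLittlewoodDimOne`) up to the sieve
constant, unconditionally and uniformly in the shifts `≤ L N`; the sharp constant `C = 1 + ε` is
`UpperRelativeDimOne` (Siegel-zero-hard, tree). [cite: HalberstamRichert1974, Thm. 2.5 and §5.7]
[cite: FriedlanderIwaniecOpera2010, Cor. 6.10] [cite: GreenTao2010, Conj. 1.2] -/
theorem uniformUpperBound (t L : ℕ) (ht : 1 ≤ t) :
    ∃ C : ℝ, 0 < C ∧ ∀ ε : ℝ, 0 < ε → ∃ N₀ : ℕ, ∀ N : ℕ, N₀ ≤ N →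
      ∀ Ψ : Fin t → AffLinForm 1, IsNondegenerateSystem Ψ → affLinSize Ψ N ≤ L →
        ∀ K : Set (Fin 1 → ℝ), Convex ℝ K → K ⊆ realBox 1 N →
          vonMangoldtSum Ψ K N ≤ C * (archFactor Ψ K * singularProduct Ψ) + ε * N := by
  -- the Fundamental Lemma constant at dimension `2(L+t)`
  obtain ⟨CFL, hCFLpos, hFL⟩ := SieveSequence.fundamental_lemma_uniform_holds (2 * ((L + t : ℕ) : ℝ))
    (((2 * (L + t) + 1 : ℕ) : ℝ) ^ (2 * (L + t) + 1) *
      Real.exp (2 * ((L + t : ℕ) : ℝ) * (9 / 2 + 6 / Real.log 2)))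
  refine ⟨2 * (1 + CFL) * 34 ^ t, by positivity, fun ε hε => ?_⟩
  -- thresholds in `N`
  have hev : ∀ᶠ N : ℕ in atTop, ((16 : ℝ) ≤ N ∧ 1 ≤ Real.log N) ∧
      (((L : ℝ) + 4 * t ^ 2 + t + 2 ≤ (N : ℝ) ^ ((1 : ℝ) / 17)) ∧
      (((N : ℝ) ^ ((1 : ℝ) / 17) + 1 ≤ (N : ℝ) ^ ((1 : ℝ) / 8)) ∧
      ((((2 * L : ℕ) : ℝ) ≤ N) ∧
      (Real.log (2 * L * N) ^ t *
        ((1 + CFL) + (⌊(N : ℝ) ^ ((1 : ℝ) / 8)⌋₊ : ℝ) ^ 2 + 2 * t * (2 * (N : ℝ) ^ ((1 : ℝ) / 17) + 1) +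
          t * ((Nat.sqrt (2 * L * N) : ℝ) * (Nat.log 2 (2 * L * N) : ℝ))) ≤ ε * N)))) :=
    eventually_basic.and ((eventually_rpow_ge _ (by norm_num)).and (eventually_level.and
      ((eventually_ge_real _).and (eventually_junk_le t L hCFLpos.le hε))))
  obtain ⟨N₀, hN₀⟩ := eventually_atTop.mp hev
  refine ⟨N₀, fun N hN Ψ hΨ hL K hK hKN => ?_⟩
  obtain ⟨⟨h16, hlog1⟩, hB17, hlevel, h2L, hjunk⟩ := hN₀ N hN
  have hNpos : (0 : ℝ) < N := by linarith
  have hN1 : 1 ≤ N := by exact_mod_cast (show (1 : ℝ) ≤ N by linarith)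
  have ht0 : (0 : ℝ) ≤ t := Nat.cast_nonneg t
  have hL0 : (0 : ℝ) ≤ L := Nat.cast_nonneg L
  have h4t : (0 : ℝ) ≤ 4 * (t : ℝ) ^ 2 := by positivity
  have hy1 : (1 : ℝ) ≤ (N : ℝ) ^ ((1 : ℝ) / 17) := by
    have : (1 : ℝ) ≤ (L : ℝ) + 4 * t ^ 2 + t + 2 := by linarith
    exact this.trans hB17
  -- Step 1: the sum against the rough points (prelims)
  have hS := vonMangoldtSum_le_card_rough hN1 Ψ hΨ hL K ht hy1
  -- Step 2: the rough points against the main term (sieve)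
  have hRmain := rough_main_le hCFLpos.le hFL rfl rfl h16 hlog1 hB17 hlevel h2L ht hΨ hL hK hKN
  -- Step 3: assembly with the junk
  have hb0 : 0 ≤ Real.log (2 * L * N) ^ t := by
    refine pow_nonneg (Real.log_nonneg ?_) t
    have hL1 : (1 : ℝ) ≤ L := one_le_of_affLinSize_le Ψ hΨ hL ⟨0, ht⟩
    have hN1r : (1 : ℝ) ≤ N := by linarith
    calc (1 : ℝ) = 1 * 1 := by ring
      _ ≤ (2 * L) * N := mul_le_mul (by linarith) hN1r zero_le_one (by linarith)
      _ = 2 * L * N := by ring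
  have hsplit : Real.log (2 * L * N) ^ t *
      ((#((latticeBox 1 N).filter (fun n => realPoint n ∈ K ∧
          ∀ i, (N : ℝ) ^ ((1 : ℝ) / 17) < (Nat.minFac ((Ψ i).eval n).toNat : ℝ))) : ℝ) +
        2 * t * (2 * (N : ℝ) ^ ((1 : ℝ) / 17) + 1) +
        t * ((Nat.sqrt (2 * L * N) : ℝ) * (Nat.log 2 (2 * L * N) : ℝ))) =
      Real.log (2 * L * N) ^ t *
        (#((latticeBox 1 N).filter (fun n => realPoint n ∈ K ∧
          ∀ i, (N : ℝ) ^ ((1 : ℝ) / 17) < (Nat.minFac ((Ψ i).eval n).toNat : ℝ))) : ℝ) +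
      Real.log (2 * L * N) ^ t * (2 * t * (2 * (N : ℝ) ^ ((1 : ℝ) / 17) + 1) +
        t * ((Nat.sqrt (2 * L * N) : ℝ) * (Nat.log 2 (2 * L * N) : ℝ))) := by ring
  have hjunk' : Real.log (2 * L * N) ^ t * ((1 + CFL) + (⌊(N : ℝ) ^ ((1 : ℝ) / 8)⌋₊ : ℝ) ^ 2) +
      Real.log (2 * L * N) ^ t * (2 * t * (2 * (N : ℝ) ^ ((1 : ℝ) / 17) + 1) +
        t * ((Nat.sqrt (2 * L * N) : ℝ) * (Nat.log 2 (2 * L * N) : ℝ))) ≤ ε * N := by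
    rw [← mul_add, ← add_assoc]; exact hjunk
  linarith

/-- **Corollary — the one-sided form of the stub's conclusion.**  Uniformly over `‖Ψ‖_N ≤ L` and convex
`K ⊆ [−N, N]`, the signed Hardy–Littlewood error is bounded ABOVE by `(C − 1) β_∞ ∏_p β_p + ε N`
(`stub_shiftLift` / `GeneralizedHardyLittlewoodDimOne` assert `|error| ≤ ε N`). [cite: GreenTao2010, Conj. 1.2] -/
theorem uniformUpperDeviation (t L : ℕ) (ht : 1 ≤ t) :
    ∃ C : ℝ, 0 < C ∧ ∀ ε : ℝ, 0 < ε → ∃ N₀ : ℕ, ∀ N : ℕ, N₀ ≤ N →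
      ∀ Ψ : Fin t → AffLinForm 1, IsNondegenerateSystem Ψ → affLinSize Ψ N ≤ L →
        ∀ K : Set (Fin 1 → ℝ), Convex ℝ K → K ⊆ realBox 1 N →
          vonMangoldtSum Ψ K N - archFactor Ψ K * singularProduct Ψ ≤
            (C - 1) * (archFactor Ψ K * singularProduct Ψ) + ε * N := by
  obtain ⟨C, hC, h⟩ := uniformUpperBound t L ht
  refine ⟨C, hC, fun ε hε => ?_⟩
  obtain ⟨N₀, hN₀⟩ := h ε hε
  refine ⟨N₀, fun N hN Ψ hΨ hL K hK hKN => ?_⟩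
  have := hN₀ N hN Ψ hΨ hL K hK hKN
  linarith


end Summit.Parity.GeneralizedHardyLittlewood.TwinLowerDensityToGHLUniformUpperBound

end
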